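import Summits.SmoothPoincare4.SmoothPoincare4.Theorems.CylinderEntropyCylinderRungTwoTiltExcess
import Mathlib.Analysis.Calculus.ParametricIntegral
import Mathlib.Analysis.SpecialFunctions.ExpDeriv
import HarnessLib

/-!
# Route `CylinderEntropy`, crux `CylinderRungTwo` (stmt-SmoothPoincare4-7631), line `killing-flux`:
# the scale derivative of the Gaussian density `F(s) = ∫_M G_s(f w) dμ_g`
# (registered helper `helper_gaussianDensity_hasDerivAt`, step H3 of the static monotonicity)

For a closed immersed cross-section `f : M⁴ → ℝ⁶` (a spacelike immersion for the Euclidean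
metric, `g = f^*δ` the induced Riemannian metric, `μ_g` its Riemannian measure — a FINITE measure
on the compact `M`, `isFiniteMeasure_riemannianMeasure`), a centre `x₀ ∈ ℝ⁶` and the backward
heat kernel profile of `ℝ⁴`

  `G_s(z) = (4πs)⁻² exp(-‖z - x₀‖² / (4s))`,

the GAUSSIAN DENSITY `F(s) = ∫_M G_s(f w) dμ_g(w)` is differentiable at every scale `τ > 0` with

  `F'(τ) = ∫_M ∂_s G_s(f w)|_{s = τ} dμ_g = ∫_M G_τ(f w) (‖f w - x₀‖² / (4τ²) - 2/τ) dμ_g`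

(`∂_s[(4πs)⁻² e^{-c/(4s)}] = (4πs)⁻² e^{-c/(4s)} (c/(4s²) - 2/s)`, `c = ‖f w - x₀‖²`). This is
the elementary first step of the static (Colding–Minicozzi / Ecker) Gaussian monotonicity for
cross-sections; the geometric input (Green's identity for `G_τ ∘ f`) is elsewhere.

Proof: differentiation under the integral sign (`hasDerivAt_integral_of_dominated_loc_of_deriv_le`)
on the ball of scales `|s - τ| < τ/2`: the integrand is continuous in `w` (`f` is continuous),
hence measurable and integrable on the compact `M`; it is differentiable in `s > 0` with the
displayed derivative (`hasDerivAt_gaussianProfile_scale`); and for `τ/2 < s`, `0 ≤ c ≤ C`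
(`C` a bound of `‖f - x₀‖²` on the compact `M`) the derivative is bounded by the constant
`(2πτ)⁻² (C/τ² + 4/τ)` (`e^{-c/(4s)} ≤ 1`, `(2πτ)² ≤ (4πs)²`, `c/(4s²) ≤ C/τ²`, `2/s ≤ 4/τ`),
which is integrable for the finite measure `μ_g`.

* `hasDerivAt_gaussianProfile_scale` — the pointwise `s`-derivative of `(4πs)⁻² e^{-c/(4s)}`;
* `abs_gaussianProfile_scaleDeriv_le` — the uniform bound of that derivative for `τ/2 < s`;
* `hasDerivAt_integral_gaussianProfile` — the derivative of `F`, implicit binders;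
* `helper_gaussianDensity_hasDerivAt` — the registered helper, verbatim.

Everything here is PROVED (no `sorry`, no new definitions, no named facts).

References: T. H. Colding, W. P. Minicozzi II, *Generic mean curvature flow I; generic
singularities*, Ann. of Math. 175 (2012) 755–833, §3 (the `F`-functional and its first
variation in the scale); K. Ecker, *Regularity Theory for Mean Curvature Flow* (2004), §3.
-/

-- the prescribed namespace `Summit.SmoothPoincare4.SmoothPoincare4.…` repeats `SmoothPoincare4`
set_option linter.dupNamespace false

noncomputable section

open Bundle Set Function Filter MeasureTheory Module
open scoped Manifold ContDiff Topology RealInnerProductSpace BigOperators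

namespace Summit.SmoothPoincare4.SmoothPoincare4.Cruxes.CylinderRungTwo.KillingFlux

open Literature.Geometry.Riemannian Literature.Geometry.Riemannian.EuclideanHypersurface
open Literature.Geometry.Lorentzian Literature.Geometry.Lorentzian.PseudoRiemannianMetric

/-! ## Calculus of the profile `s ↦ (4πs)⁻² e^{-c/(4s)}` -/

section Profile

/-- The scale derivative of the backward heat kernel profile of `ℝ⁴`:
`d/ds [(4πs)⁻² e^{-c/(4s)}] = (4πs)⁻² e^{-c/(4s)} · (c/(4s²) - 2/s)` for `s > 0`
(chain, quotient and power rules). [folklore] -/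
theorem hasDerivAt_gaussianProfile_scale (c : ℝ) {s : ℝ} (hs : 0 < s) :
    HasDerivAt (fun s : ℝ => Real.exp (-c / (4 * s)) / (4 * Real.pi * s) ^ 2)
      ((Real.exp (-c / (4 * s)) / (4 * Real.pi * s) ^ 2) * (c / (4 * s ^ 2) - 2 / s)) s := by
  have h4s : (4 : ℝ) * s ≠ 0 := by positivity
  have hden : (4 * Real.pi * s) ^ 2 ≠ 0 := by positivity
  have h1 : HasDerivAt (fun s : ℝ => -c / (4 * s)) (c / (4 * s ^ 2)) s := by
    refine ((hasDerivAt_const s (-c)).div (hasDerivAt_const_mul (4 : ℝ)) h4s).congr_deriv ?_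
    field_simp
    ring
  have h3 : HasDerivAt (fun s : ℝ => (4 * Real.pi * s) ^ 2)
      (((2 : ℕ) : ℝ) * (4 * Real.pi * s) ^ (2 - 1) * (4 * Real.pi)) s :=
    (hasDerivAt_const_mul (4 * Real.pi)).fun_pow 2
  refine ((h1.exp).div h3 hden).congr_deriv ?_
  norm_num
  field_simp

/-- Uniform bound of the scale derivative near `τ > 0`: for `τ/2 < s` and `0 ≤ c ≤ C`,
`|(4πs)⁻² e^{-c/(4s)} (c/(4s²) - 2/s)| ≤ (2πτ)⁻² (C/τ² + 4/τ)`
(`e^{-c/(4s)} ≤ 1`, `(2πτ)² ≤ (4πs)²`, `c/(4s²) ≤ C/τ²`, `2/s ≤ 4/τ`). [folklore] -/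
theorem abs_gaussianProfile_scaleDeriv_le {τ s c C : ℝ} (hτ : 0 < τ) (hs : τ / 2 < s)
    (hc : 0 ≤ c) (hcC : c ≤ C) :
    |(Real.exp (-c / (4 * s)) / (4 * Real.pi * s) ^ 2) * (c / (4 * s ^ 2) - 2 / s)| ≤
      1 / (2 * Real.pi * τ) ^ 2 * (C / τ ^ 2 + 4 / τ) := by
  have hs0 : 0 < s := (half_pos hτ).trans hs
  have hC : 0 ≤ C := hc.trans hcC
  have hA : Real.exp (-c / (4 * s)) / (4 * Real.pi * s) ^ 2 ≤ 1 / (2 * Real.pi * τ) ^ 2 := by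
    have he : Real.exp (-c / (4 * s)) ≤ 1 :=
      Real.exp_le_one_iff.2 (div_nonpos_of_nonpos_of_nonneg (neg_nonpos.2 hc) (by positivity))
    have hd : (2 * Real.pi * τ) ^ 2 ≤ (4 * Real.pi * s) ^ 2 :=
      pow_le_pow_left₀ (by positivity) (by nlinarith [Real.pi_pos]) 2
    exact div_le_div₀ zero_le_one he (by positivity) hd
  have hB : |c / (4 * s ^ 2) - 2 / s| ≤ C / τ ^ 2 + 4 / τ := by
    have h1 : c / (4 * s ^ 2) ≤ C / τ ^ 2 :=
      calc c / (4 * s ^ 2) ≤ c / τ ^ 2 :=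
            div_le_div_of_nonneg_left hc (by positivity) (by nlinarith)
        _ ≤ C / τ ^ 2 := div_le_div_of_nonneg_right hcC (by positivity)
    have h2 : 2 / s ≤ 4 / τ := by
      rw [div_le_div_iff₀ hs0 hτ]
      linarith
    have h3 : 0 ≤ c / (4 * s ^ 2) := by positivity
    have h4 : 0 < 2 / s := by positivity
    have h5 : 0 ≤ C / τ ^ 2 := by positivity
    rw [abs_le]
    constructor <;> linarith
  rw [abs_mul, abs_of_nonneg (by positivity : 0 ≤ Real.exp (-c / (4 * s)) / (4 * Real.pi * s) ^ 2)]
  exact mul_le_mul hA hB (abs_nonneg _) (by positivity)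

end Profile

/-! ## The scale derivative of the Gaussian density -/

section Density

variable {M : Type*} [TopologicalSpace M] [ChartedSpace (EuclideanSpace ℝ (Fin 4)) M]
  [IsManifold (𝓡 4) ∞ M] [CompactSpace M] [T2Space M] [MeasurableSpace M] [BorelSpace M]

/-- **Scale derivative of the Gaussian density of a closed immersed `M⁴ ↬ ℝ⁶`.** For a spacelike
immersion `f : M → ℝ⁶` of a compact `M` (induced metric `g = f^*δ`, Riemannian measure `μ_g`),
`x₀ ∈ ℝ⁶` and `τ > 0`, the Gaussian density `F(s) = ∫_M (4πs)⁻² e^{-‖f w - x₀‖²/(4s)} dμ_g(w)`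
has derivative `F'(τ) = ∫_M (4πτ)⁻² e^{-‖f w - x₀‖²/(4τ)} (‖f w - x₀‖²/(4τ²) - 2/τ) dμ_g(w)`:
differentiation under the integral sign (`hasDerivAt_integral_of_dominated_loc_of_deriv_le`) on
the scales `|s - τ| < τ/2`, the `s`-derivative being bounded there by a constant
(`abs_gaussianProfile_scaleDeriv_le`, `‖f - x₀‖²` is bounded on the compact `M`), integrable for
the finite measure `μ_g`. [cite: ColdingMinicozzi2012, §3] -/
theorem hasDerivAt_integral_gaussianProfile {f : M → EuclideanSpace ℝ (Fin 6)}
    (hf : (euclideanMetric (EuclideanSpace ℝ (Fin 6))).IsSpacelikeImmersion (𝓡 4) f)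
    (x₀ : EuclideanSpace ℝ (Fin 6)) {τ : ℝ} (hτ : 0 < τ) :
    HasDerivAt (fun s : ℝ => ∫ w, Real.exp (-‖f w - x₀‖ ^ 2 / (4 * s)) / (4 * Real.pi * s) ^ 2
        ∂riemannianMeasure ((euclideanMetric (EuclideanSpace ℝ (Fin 6))).inducedRiemannianMetric f
          contMDiff_pullbackBilin_holds hf))
      (∫ w, (Real.exp (-‖f w - x₀‖ ^ 2 / (4 * τ)) / (4 * Real.pi * τ) ^ 2) *
          (‖f w - x₀‖ ^ 2 / (4 * τ ^ 2) - 2 / τ)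
        ∂riemannianMeasure ((euclideanMetric (EuclideanSpace ℝ (Fin 6))).inducedRiemannianMetric f
          contMDiff_pullbackBilin_holds hf)) τ := by
  set g₁ := (euclideanMetric (EuclideanSpace ℝ (Fin 6))).inducedRiemannianMetric f
    contMDiff_pullbackBilin_holds hf with hg₁
  haveI : IsFiniteMeasure (riemannianMeasure g₁) := isFiniteMeasure_riemannianMeasure g₁
  have hfc : Continuous f := hf.contMDiff_self.continuous
  -- the squared distance to the centre, continuous and bounded on the compact `M`
  have hcc : Continuous fun w => ‖f w - x₀‖ ^ 2 := by fun_prop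
  obtain ⟨C, hC⟩ : ∃ C : ℝ, ∀ w, ‖f w - x₀‖ ^ 2 ≤ C := by
    obtain ⟨C, hC⟩ := isCompact_univ.exists_bound_of_continuousOn
      (f := fun w => ‖f w - x₀‖ ^ 2) hcc.continuousOn
    exact ⟨C, fun w => (Real.le_norm_self _).trans (hC w (mem_univ w))⟩
  -- the ball of scales `|s - τ| < τ/2`, on which `τ/2 < s`
  have hτ2 : 0 < τ / 2 := half_pos hτ
  have hball : Metric.ball τ (τ / 2) ∈ 𝓝 τ := Metric.ball_mem_nhds τ hτ2
  have hsI : ∀ s ∈ Metric.ball τ (τ / 2), τ / 2 < s := fun s hs => by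
    rw [Metric.mem_ball, Real.dist_eq, abs_lt] at hs
    linarith [hs.1]
  have key := hasDerivAt_integral_of_dominated_loc_of_deriv_le (μ := riemannianMeasure g₁) (𝕜 := ℝ)
    (F := fun s w => Real.exp (-‖f w - x₀‖ ^ 2 / (4 * s)) / (4 * Real.pi * s) ^ 2)
    (F' := fun s w => (Real.exp (-‖f w - x₀‖ ^ 2 / (4 * s)) / (4 * Real.pi * s) ^ 2) *
      (‖f w - x₀‖ ^ 2 / (4 * s ^ 2) - 2 / s))
    (bound := fun _ => 1 / (2 * Real.pi * τ) ^ 2 * (C / τ ^ 2 + 4 / τ))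
    hball ?_ ?_ ?_ ?_ ?_ ?_
  · exact key.2
  · -- measurability of the integrand at every scale: it is continuous in `w`
    exact Eventually.of_forall fun s =>
      (Continuous.aestronglyMeasurable (by fun_prop))
  · -- integrability at `τ`: continuous on the compact `M`
    exact integrable_of_continuous (h := g₁) (by fun_prop)
  · -- measurability of the derivative at `τ`
    exact Continuous.aestronglyMeasurable (by fun_prop)
  · -- the uniform bound on the ball of scales
    refine Eventually.of_forall fun w s hs => ?_
    rw [Real.norm_eq_abs]
    exact abs_gaussianProfile_scaleDeriv_le hτ (hsI s hs) (sq_nonneg _) (hC w)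
  · exact integrable_const _
  · -- pointwise differentiability in the scale
    refine Eventually.of_forall fun w s hs => ?_
    exact hasDerivAt_gaussianProfile_scale (‖f w - x₀‖ ^ 2) (hτ2.trans (hsI s hs))

end Density

/-- **Registered helper `helper_gaussianDensity_hasDerivAt` of line `killing-flux` (step H3 of the
static Gaussian monotonicity for cross-sections).** For a closed immersed `f : M⁴ → ℝ⁶`, `x₀ ∈ ℝ⁶`
and `τ > 0`: `d/ds|_{s=τ} ∫_M (4πs)⁻² e^{-‖f w - x₀‖²/(4s)} dμ_g
= ∫_M (4πτ)⁻² e^{-‖f w - x₀‖²/(4τ)} (‖f w - x₀‖²/(4τ²) - 2/τ) dμ_g`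
(`hasDerivAt_integral_gaussianProfile`). [cite: ColdingMinicozzi2012, §3] -/
theorem helper_gaussianDensity_hasDerivAt : ∀ (M : Type) [TopologicalSpace M] [ChartedSpace (EuclideanSpace ℝ (Fin 4)) M] [IsManifold (𝓡 4) ∞ M] [CompactSpace M] [T2Space M] [MeasurableSpace M] [BorelSpace M] (f : M → EuclideanSpace ℝ (Fin 6)) (hf : (Literature.Geometry.Riemannian.euclideanMetric (EuclideanSpace ℝ (Fin 6))).IsSpacelikeImmersion (𝓡 4) f) (x₀ : EuclideanSpace ℝ (Fin 6)) (τ : ℝ), 0 < τ → HasDerivAt (fun s : ℝ => ∫ w, Real.exp (-‖f w - x₀‖ ^ 2 / (4 * s)) / (4 * Real.pi * s) ^ 2 ∂Literature.Geometry.Lorentzian.riemannianMeasure ((Literature.Geometry.Riemannian.euclideanMetric (EuclideanSpace ℝ (Fin 6))).inducedRiemannianMetric f Literature.Geometry.Lorentzian.PseudoRiemannianMetric.contMDiff_pullbackBilin_holds hf)) (∫ w, (Real.exp (-‖f w - x₀‖ ^ 2 / (4 * τ)) / (4 * Real.pi * τ) ^ 2) * (‖f w - x₀‖ ^ 2 /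 (4 * τ ^ 2) - 2 / τ) ∂Literature.Geometry.Lorentzian.riemannianMeasure ((Literature.Geometry.Riemannian.euclideanMetric (EuclideanSpace ℝ (Fin 6))).inducedRiemannianMetric f Literature.Geometry.Lorentzian.PseudoRiemannianMetric.contMDiff_pullbackBilin_holds hf)) τ :=
  fun _ _ _ _ _ _ _ _ _ hf x₀ _ hτ => hasDerivAt_integral_gaussianProfile hf x₀ hτ

end Summit.SmoothPoincare4.SmoothPoincare4.Cruxes.CylinderRungTwo.KillingFlux

end
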